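import Summits.BirchSwinnertonDyer.BirchSwinnertonDyer.Theorems.BiquadraticEisensteinDescentHeegnerTwistCouplingInSupplySylvesterTwistPointDescent
import Summits.BirchSwinnertonDyer.BirchSwinnertonDyer.Theorems.BiquadraticEisensteinDescentHeegnerTwistCouplingInSupplySylvesterTwistPhiCubes
import Summits.BirchSwinnertonDyer.BirchSwinnertonDyer.Theorems.BiquadraticEisensteinDescentHeegnerTwistCouplingInSupplySylvesterTwistPhiHatCubes
import Literature.NumberTheory.EllipticCurves.IsogenyQuotientUniqueProofs
import Literature.NumberTheory.EllipticCurves.MordellWeilTheoremProofs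
import Mathlib.RingTheory.Finiteness.Nakayama
import Mathlib.LinearAlgebra.Dimension.Finite
import HarnessLib

set_option linter.dupNamespace false -- `Summit.BirchSwinnertonDyer.BirchSwinnertonDyer.Theorems.…` (summit = sub, D-0017)
set_option autoImplicit false

/-!
# Crux `HeegnerTwistCouplingInSupply` (stmt-BirchSwinnertonDyer-21381) — programme «TWISTED 3-ISOGENY DESCENT», file P7c-C2:
# `rank E(ℚ) = 0` for the Sylvester twist `E : y² = x³ − 2p²` (`p ≡ 8 (mod 9)`, `p = a² + 2b²`) under the certificates (h1) ∧ (h2)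

Route `BiquadraticEisensteinDescent` (cell `pub/bsd-wall`, width seat `bsd-wall-cm-bed-w4` g33; `--supports` 21381, helper). The RANK
half of the descent: with `φ : E → E' = mordellCurve(54p²)` and `φ'' : E' → E'' = mordellCurve(−1458p²)` the kernel-`x` `3`-isogenies
over `ℚ` and `ψ = φ̂` the abstract dual of `φ` (`ψφ = [3]`):

* §1 `exists_fixed_preimage_phi` — `E'(ℚ) ⊆ φ(E(ℚ))` (generic point descent P7c-C1 over `F = ℚ(√6)` with the Selmer-form box P7c-B1,
  certificate (h1)); `exists_fixed_preimage_phi''` — `E''(ℚ) ⊆ φ''(E'(ℚ))` (over `K = ℚ(√−2)`, box P7c-B2, certificate (h2) `9 ∤ a`);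
* §2 ★★ `exists_eq_three_nsmul` — `ker ψ = ker φ''` (P7c-A2: `dual_ker_subset`, `dual_apply_eq_zero_of_x_eq_zero`), so
  `φ'' = λ ∘ ψ` with `λ : E → E''` of degree `1` (tree `Isogeny.exists_eq_comp_of_ker_le`, `degree_eq_one_of_comp_eq`), hence
  `E(ℚ) ⊆ ψ(E'(ℚ))`; with §1, EVERY `P ∈ E(ℚ)` is `ψφQ = 3Q` for a `Q ∈ E(ℚ)` (Galois descent `E(ℚ) = E(ℚ̄)^{Γ_ℚ}`, tree
  `toGeomPoints`);
* §3 ★★★ `mordellWeilRank_sylvesterTwist_eq_zero` — **`rank E(ℚ) = 0`**: `E(ℚ)` is finitely generated (Mordell–Weil, tree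
  `module_finite_point_holds`) and `E(ℚ) = 3E(ℚ)`, so Nakayama gives `r ≡ 1 (mod 3)` with `r·E(ℚ) = 0`, i.e. `E(ℚ)` is torsion.

HONEST FRAMING: the rank of ONE CM family under the two decidable certificates (h1) and (h2); the corner theorem (`L(W_p^{(−8)}, 1) ≠ 0` via
Burungale–Tian and the crux conclusion at `(W_p, p)`) is the next file; `hDescU` in its one-certificate shape, the crux (residual C⁺) and BSD
are untouched. THEOREMS ONLY (no `def`, no named fact, no sorry). Supports stmt-BirchSwinnertonDyer-21381.
[cite: CohenPazuki2009, Theorem 2.1, Proposition 2.2] [cite: SilvermanAEC2009, Thm. X.4.2, Remark X.4.7, Cor. III.4.11, Thm. VIII.6.7]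
-/

noncomputable section

open scoped Classical

namespace Summit.BirchSwinnertonDyer.BirchSwinnertonDyer.Theorems.SylvesterTwistDescent

open Literature.NumberTheory.EllipticCurves Literature.NumberTheory.EllipticCurves.MordellDescent
open Literature.NumberTheory.EllipticCurves.TwistedKummer Literature.NumberTheory.QuadraticFields
open Literature.NumberTheory.GaloisRepresentations NumberField
open WeierstrassCurve

variable {F : Type} [Field F] [NumberField F] (hF2 : Module.finrank ℚ F = 2) {ω : F} (hω : ω ^ 2 = 6) (cF : F ≃ₐ[ℚ] F)
  (hcF : cF ≠ 1) {K : Type} [Field K] [NumberField K] {θ : K} (hK : SqrtNegTwo.FieldData θ) (cK : K ≃ₐ[ℚ] K) (hcK : cK ≠ 1)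
  {p : ℕ} (hp : p.Prime) (hp9 : p % 9 = 8) {a b : ℤ} (hab : a ^ 2 + 2 * b ^ 2 = p)

/-! ## §1 The two point descents -/

include hF2 hω hcF hp hp9 hab in
/-- **`E'(ℚ) ⊆ φ(E(ℚ))`** for `φ : y² = x³ − 2p² → y² = x³ + 54p²` under (h1): P7c-C1 over `F = ℚ(√6)` (`ω² = 6`, `c₁ = pω/3`) with the
Selmer-form box P7c-B1. [cite: CohenPazuki2009, Proposition 2.2] [cite: SilvermanAEC2009, Thm. X.4.2 (a)] -/
theorem exists_fixed_preimage_phi (h1 : ∃ u₀ : (𝓞 F)ˣ, ∀ x : 𝓞 F, (u₀ : 𝓞 F) - x ^ 3 ∉ Ideal.span {(p : 𝓞 F)})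
    (hX : IsKernelXThreePair (0 : ℚ) 0 (-2 * (p : ℚ) ^ 2) (mordellCurve (-2 * (p : ℚ) ^ 2)) (mordellCurve (54 * (p : ℚ) ^ 2)))
    {P' : geomPoints (mordellCurve (54 * (p : ℚ) ^ 2))} (hP' : ∀ σ : Field.absoluteGaloisGroup ℚ, σ • P' = P') :
    ∃ Q : geomPoints (mordellCurve (-2 * (p : ℚ) ^ 2)), (∀ σ : Field.absoluteGaloisGroup ℚ, σ • Q = Q) ∧ hX.toIsogeny Q = P' := by
  have hcω : cF ω = -ω := algEquiv_omega hF2 hω hcF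
  have hd24 := discr_eq_twentyFour hF2 hω
  have hL : ∀ q : F, q ^ 2 ≠ -3 := sq_ne_neg_three_of_discr_pos hF2 (by rw [hd24]; norm_num)
  obtain ⟨cbar, hcbar, hcbθ⟩ := exists_lift_neg_theta' hL (cF : F ≃+* F)
  have hω' : ω ^ 2 = ((6 : ℚ) : F) := by rw [hω]; norm_num
  have hωQ : ω ∉ Set.range (algebraMap ℚ F) := omega_not_mem_range hω
  have hp0 : (p : ℚ) ≠ 0 := Nat.cast_ne_zero.mpr hp.ne_zero
  have hk : (-2 * (p : ℚ) ^ 2) ≠ 0 := mul_ne_zero (by norm_num) (pow_ne_zero 2 hp0)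
  have hk'sq : ∀ q : ℚ, q ^ 2 ≠ 54 * (p : ℚ) ^ 2 := by
    intro q hq
    apply hωQ
    have h3p : (3 * (p : ℚ)) ≠ 0 := mul_ne_zero three_ne_zero hp0
    have hsq : (algebraMap ℚ F (q / (3 * p))) ^ 2 = ω ^ 2 := by
      rw [← map_pow, div_pow, hq, hω, eq_ratCast, show (54 * (p : ℚ) ^ 2 / (3 * p) ^ 2 : ℚ) = 6 by field_simp; ring]
      norm_num
    rcases sq_eq_sq_iff_eq_or_eq_neg.mp hsq with h | h
    · exact ⟨_, h⟩
    · exact ⟨-(q / (3 * p)), by rw [map_neg, h, neg_neg]⟩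
  have hω0 : ω ≠ 0 := fun h => by rw [h] at hω; norm_num at hω
  have hc₁ : (p * ω / 3 : F) ≠ 0 := div_ne_zero (mul_ne_zero (Nat.cast_ne_zero.mpr hp.ne_zero) hω0) three_ne_zero
  have hkc₁ : (((-2 * (p : ℚ) ^ 2 : ℚ)) : F) = -3 * (p * ω / 3) ^ 2 := by
    push_cast; linear_combination ((p : F) ^ 2 / 3) * hω
  have hcc₁ : cF (p * ω / 3) = -(p * ω / 3) := by rw [map_div₀, map_mul, map_natCast, map_ofNat, hcω]; ring
  refine exists_fixed_preimage_of_fixed hF2 hω' hωQ cF hcω cbar hcbar hcbθ hk (by ring) hk'sq hX hc₁ hkc₁ hcc₁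
    (fun hD u hu hnorm hsha => ?_) hP'
  obtain ⟨w, -, hw⟩ := exists_eq_cube_of_mem_sha_of_norm_cube_phi hF2 hω cF hp hp9 hab h1 hc₁ hD hu hnorm hsha
  exact ⟨w, hw⟩

include hK hcK hp hp9 hab in
/-- **`E''(ℚ) ⊆ φ''(E'(ℚ))`** for `φ'' : y² = x³ + 54p² → y² = x³ − 1458p²` under (h2) `9 ∤ a`: P7c-C1 over `K = ℚ(√−2)` (`θ² = −2`,
`c₁ = 3pθ`) with the Selmer-form box P7c-B2. [cite: CohenPazuki2009, Proposition 2.2] [cite: SilvermanAEC2009, Thm. X.4.2 (a)] -/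
theorem exists_fixed_preimage_phi'' (h9 : ¬ (9 : ℤ) ∣ a)
    (hX' : IsKernelXThreePair (0 : ℚ) 0 (54 * (p : ℚ) ^ 2) (mordellCurve (54 * (p : ℚ) ^ 2)) (mordellCurve (-1458 * (p : ℚ) ^ 2)))
    {P'' : geomPoints (mordellCurve (-1458 * (p : ℚ) ^ 2))} (hP'' : ∀ σ : Field.absoluteGaloisGroup ℚ, σ • P'' = P'') :
    ∃ Q' : geomPoints (mordellCurve (54 * (p : ℚ) ^ 2)), (∀ σ : Field.absoluteGaloisGroup ℚ, σ • Q' = Q') ∧ hX'.toIsogeny Q' = P'' := by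
  have hK2 := hK.finrank_eq
  have hθ := hK.sq_eq
  have hcθ : cK θ = -θ := hK.algEquiv_theta hcK
  have hL : ∀ q : K, q ^ 2 ≠ -3 := sq_ne_neg_three hK
  obtain ⟨cbar, hcbar, hcbθ⟩ := exists_lift_neg_theta' hL (cK : K ≃+* K)
  have hθ' : θ ^ 2 = ((-2 : ℚ) : K) := by rw [hθ]; norm_num
  have hθQ : θ ∉ Set.range (algebraMap ℚ K) := hK.not_mem_range
  have hp0 : (p : ℚ) ≠ 0 := Nat.cast_ne_zero.mpr hp.ne_zero
  have hk : (54 * (p : ℚ) ^ 2) ≠ 0 := mul_ne_zero (by norm_num) (pow_ne_zero 2 hp0)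
  have hk'sq : ∀ q : ℚ, q ^ 2 ≠ -1458 * (p : ℚ) ^ 2 := by
    intro q hq
    have h1 : (0 : ℚ) < (p : ℚ) ^ 2 := by positivity
    nlinarith [sq_nonneg q]
  have hθ0 : θ ≠ 0 := fun h => by rw [h] at hθ; norm_num at hθ
  have hc₁ : (3 * p * θ : K) ≠ 0 := mul_ne_zero (mul_ne_zero three_ne_zero (Nat.cast_ne_zero.mpr hp.ne_zero)) hθ0
  have hkc₁ : (((54 * (p : ℚ) ^ 2 : ℚ)) : K) = -3 * (3 * p * θ) ^ 2 := by
    push_cast; linear_combination (27 * (p : K) ^ 2) * hθ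
  have hcc₁ : cK (3 * p * θ) = -(3 * p * θ) := by rw [map_mul, map_mul, map_natCast, map_ofNat, hcθ]; ring
  exact exists_fixed_preimage_of_fixed hK2 hθ' hθQ cK hcθ cbar hcbar hcbθ hk (by ring) hk'sq hX' hc₁ hkc₁ hcc₁
    (fun hD u hu hnorm hsha => exists_eq_cube_of_mem_sha_of_norm_cube_phiHat hK cK hcK hp hp9 hab h9 hc₁ hD hu hnorm hsha) hP''

/-! ## §2 Every rational point of `E` is `3Q` -/

include hF2 hω hcF hK hcK hp hp9 hab in
/-- ★★ **`E(ℚ) = 3E(ℚ)`** for `E : y² = x³ − 2p²` under (h1) ∧ (h2), read in `E(ℚ̄)` along `E(ℚ) ↪ E(ℚ̄)` (`toGeomPoints`). With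
`φ : E → E'`, `φ'' : E' → E''` the kernel-`x` isogenies and `ψ` the dual of `φ`: `ker ψ = ker φ'' = {O, (0, ±3p√6)}` (P7c-A2), so
`φ'' = λψ` with `λ` injective; for `P ∈ E(ℚ)`, `λP ∈ E''(ℚ) = φ''(E'(ℚ))` gives `P = ψQ'`, `Q' ∈ E'(ℚ) = φ(E(ℚ))`, so `P = ψφQ = 3Q`.
[cite: CohenPazuki2009, Theorem 2.1] [cite: SilvermanAEC2009, Remark X.4.7, Cor. III.4.11] -/
theorem exists_toGeomPoints_eq_three_nsmul (h9 : ¬ (9 : ℤ) ∣ a)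
    (h1 : ∃ u₀ : (𝓞 F)ˣ, ∀ x : 𝓞 F, (u₀ : 𝓞 F) - x ^ 3 ∉ Ideal.span {(p : 𝓞 F)})
    [(mordellCurve (-2 * (p : ℚ) ^ 2)).IsElliptic] (P : (mordellCurve (-2 * (p : ℚ) ^ 2)).toAffine.Point) :
    ∃ Q : (mordellCurve (-2 * (p : ℚ) ^ 2)).toAffine.Point,
      toGeomPoints (mordellCurve (-2 * (p : ℚ) ^ 2)) P = (3 : ℕ) • toGeomPoints (mordellCurve (-2 * (p : ℚ) ^ 2)) Q := by
  have hp0 : (p : ℚ) ≠ 0 := Nat.cast_ne_zero.mpr hp.ne_zero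
  have hk0 : (-2 * (p : ℚ) ^ 2) ≠ 0 := mul_ne_zero (by norm_num) (pow_ne_zero 2 hp0)
  have hk0' : (54 * (p : ℚ) ^ 2) ≠ 0 := mul_ne_zero (by norm_num) (pow_ne_zero 2 hp0)
  have hk0'' : (-1458 * (p : ℚ) ^ 2) ≠ 0 := mul_ne_zero (by norm_num) (pow_ne_zero 2 hp0)
  haveI := isElliptic_mordellCurve hk0'
  haveI := isElliptic_mordellCurve hk0''
  have hX : IsKernelXThreePair (0 : ℚ) 0 (-2 * (p : ℚ) ^ 2) (mordellCurve (-2 * (p : ℚ) ^ 2)) (mordellCurve (54 * (p : ℚ) ^ 2)) :=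
    isKernelXThreePair_mordell hk0 (by ring)
  have hX' : IsKernelXThreePair (0 : ℚ) 0 (54 * (p : ℚ) ^ 2) (mordellCurve (54 * (p : ℚ) ^ 2)) (mordellCurve (-1458 * (p : ℚ) ^ 2)) :=
    isKernelXThreePair_mordell hk0' (by ring)
  have hdeg : hX.toIsogeny.degree = 3 := hX.natCard_ker_toIsogeny
  obtain ⟨ψ, hψ⟩ := hX.toIsogeny.exists_dual_of_isElliptic
  rw [hdeg] at hψ
  -- ### `ker ψ = ker φ''`
  have hkerψ : ∀ P', ψ P' = 0 → hX'.toIsogeny P' = 0 := by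
    intro P' h
    rcases dual_ker_subset hX ψ hψ P' h with h0 | ⟨y, hy, rfl⟩
    · rw [h0]; exact map_zero _
    · rw [IsKernelXThreePair.toIsogeny_apply, hX'.geom.pointFun_some_of_eq_zero _ rfl]; rfl
  have hkerφ'' : ∀ P', hX'.toIsogeny P' = 0 → ψ P' = 0 := by
    intro P' h
    rw [IsKernelXThreePair.toIsogeny_apply] at h
    rcases (hX'.geom.pointFun_eq_zero_iff P').mp h with h0 | h0 | h0
    · rw [h0]; exact map_zero _
    · rw [h0]; exact dual_apply_eq_zero_of_x_eq_zero hF2 hω cF hcF hp hX ψ hψ hX'.gs hX'.geom.nonsingular_T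
    · have e : ψ P' = -ψ hX'.geom.T := by rw [h0]; exact map_neg ψ _
      rw [e, neg_eq_zero]; exact dual_apply_eq_zero_of_x_eq_zero hF2 hω cF hcF hp hX ψ hψ hX'.gs hX'.geom.nonsingular_T
  -- ### `φ'' = λ ∘ ψ` with `λ` injective
  have hsep : ψ.deg ≤ Nat.card ψ.toAddMonoidHom.ker := le_of_eq (Isogeny.degree_eq_deg ψ).symm
  obtain ⟨lam, hlam⟩ := ψ.exists_eq_comp_of_ker_le hX'.toIsogeny hsep hkerψ
  have hlam1 : lam.degree = 1 := Isogeny.degree_eq_one_of_comp_eq ψ hX'.toIsogeny lam hlam hkerφ''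
  have hlam_inj : Function.Injective lam := by
    intro P₁ P₂ h
    have hbot : lam.toAddMonoidHom.ker = ⊥ := (AddSubgroup.eq_bot_iff_card _).mpr hlam1
    have hmem : P₁ - P₂ ∈ lam.toAddMonoidHom.ker := by
      rw [AddMonoidHom.mem_ker, map_sub]; exact sub_eq_zero.mpr h
    rw [hbot, AddSubgroup.mem_bot] at hmem
    exact sub_eq_zero.mp hmem
  -- ### `P = ψ Q'`, `Q' = φ Q`, `P = 3Q`
  have hfix'' : ∀ σ : Field.absoluteGaloisGroup ℚ, σ • lam (toGeomPoints (mordellCurve (-2 * (p : ℚ) ^ 2)) P) =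
      lam (toGeomPoints (mordellCurve (-2 * (p : ℚ) ^ 2)) P) := fun σ => by
    rw [← lam.map_smul, smul_toGeomPoints]
  obtain ⟨Q', hQ'fix, hQ'⟩ := exists_fixed_preimage_phi'' hK cK hcK hp hp9 hab h9 hX' hfix''
  have hψQ' : ψ Q' = toGeomPoints (mordellCurve (-2 * (p : ℚ) ^ 2)) P := hlam_inj (by rw [← hlam, hQ'])
  obtain ⟨Q, hQfix, hQ⟩ := exists_fixed_preimage_phi hF2 hω cF hcF hp hp9 hab h1 hX hQ'fix
  obtain ⟨Q₀, hQ₀⟩ := exists_toGeomPoints_eq_of_forall_smul_eq (mordellCurve (-2 * (p : ℚ) ^ 2)) hQfix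
  refine ⟨Q₀, ?_⟩
  rw [hQ₀, ← hψQ', ← hQ, hψ, natCast_zsmul]

/-! ## §3 The rank -/

include hF2 hω hcF hK hcK hp hp9 hab in
/-- ★★★ **`rank E(ℚ) = 0` for the Sylvester twist `E : y² = x³ − 2p²`** (`p ≡ 8 (mod 9)` prime, `p = a² + 2b²`) under (h1) «a unit of
`𝓞_{ℚ(√6)}` is not a cube mod `p`» and (h2) «`9 ∤ a`»: the image `R ≅ E(ℚ)` of `E(ℚ)` in `E(ℚ̄)` is finitely generated (Mordell–Weil) with
`R = 3R` (§2), so by Nakayama `r·R = 0` for some `r ≡ 1 (mod 3)`, `r ≠ 0`: every rational point is torsion and `rank_ℤ E(ℚ) = 0`.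
[cite: CohenPazuki2009, Theorem 2.1] [cite: SilvermanAEC2009, Thm. VIII.6.7, Remark X.4.7] -/
theorem mordellWeilRank_sylvesterTwist_eq_zero (h9 : ¬ (9 : ℤ) ∣ a)
    (h1 : ∃ u₀ : (𝓞 F)ˣ, ∀ x : 𝓞 F, (u₀ : 𝓞 F) - x ^ 3 ∉ Ideal.span {(p : 𝓞 F)}) [(mordellCurve (-2 * (p : ℚ) ^ 2)).IsElliptic] :
    (mordellCurve (-2 * (p : ℚ) ^ 2)).mordellWeilRank = 0 := by
  -- the group law on `E(ℚ)` in the tree (`mordellWeilRank`, `toGeomPoints`, Mordell–Weil) uses classical decidability on `ℚ`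
  letI : DecidableEq ℚ := fun x y => Classical.propDecidable (x = y)
  haveI hfg := WeierstrassCurve.addGroup_fg_point_holds (mordellCurve (-2 * (p : ℚ) ^ 2))
  have hRfg : (toGeomPoints (mordellCurve (-2 * (p : ℚ) ^ 2))).range.FG :=
    (AddGroup.fg_iff_addSubgroup_fg _).mp inferInstance
  have hN : (AddSubgroup.toIntSubmodule (toGeomPoints (mordellCurve (-2 * (p : ℚ) ^ 2))).range).FG := by
    rw [Submodule.fg_iff_addSubgroup_fg, AddSubgroup.toIntSubmodule_toAddSubgroup]; exact hRfg
  have hle : AddSubgroup.toIntSubmodule (toGeomPoints (mordellCurve (-2 * (p : ℚ) ^ 2))).range ≤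
      Ideal.span {(3 : ℤ)} • AddSubgroup.toIntSubmodule (toGeomPoints (mordellCurve (-2 * (p : ℚ) ^ 2))).range := by
    intro x hx
    have hx' : x ∈ (toGeomPoints (mordellCurve (-2 * (p : ℚ) ^ 2))).range := hx
    obtain ⟨P, rfl⟩ := AddMonoidHom.mem_range.mp hx'
    obtain ⟨Q, hPQ⟩ := exists_toGeomPoints_eq_three_nsmul hF2 hω cF hcF hK cK hcK hp hp9 hab h9 h1 P
    rw [hPQ, ← natCast_zsmul]
    refine Submodule.smul_mem_smul (Ideal.mem_span_singleton_self (3 : ℤ)) ?_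
    show toGeomPoints (mordellCurve (-2 * (p : ℚ) ^ 2)) Q ∈ (toGeomPoints (mordellCurve (-2 * (p : ℚ) ^ 2))).range
    exact AddMonoidHom.mem_range.mpr ⟨Q, rfl⟩
  obtain ⟨r, hr1, hr⟩ := Submodule.exists_sub_one_mem_and_smul_eq_zero_of_fg_of_le_smul _ _ hN hle
  have hr0 : r ≠ 0 := by
    rintro rfl
    rw [zero_sub, Ideal.mem_span_singleton] at hr1
    exact absurd hr1 (by decide)
  unfold WeierstrassCurve.mordellWeilRank Module.finrank
  rw [rank_eq_zero_iff.2 fun x => ⟨r, hr0, ?_⟩]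
  · simp
  · apply toGeomPoints_injective (mordellCurve (-2 * (p : ℚ) ^ 2))
    rw [map_zsmul, map_zero]
    refine hr _ ?_
    show toGeomPoints (mordellCurve (-2 * (p : ℚ) ^ 2)) x ∈ (toGeomPoints (mordellCurve (-2 * (p : ℚ) ^ 2))).range
    exact AddMonoidHom.mem_range.mpr ⟨x, rfl⟩

end Summit.BirchSwinnertonDyer.BirchSwinnertonDyer.Theorems.SylvesterTwistDescent

end
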